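import Summits.CriticalPhenomena.PercolationContinuityZ3.Theorems.Transplant.SkelFrmFromBParamsFaceCountsRangeA
import Summits.CriticalPhenomena.PercolationContinuityZ3.Theorems.Transplant.SkelFrmBParamsFaceCountsRangeA
import Summits.CriticalPhenomena.PercolationContinuityZ3.Theorems.Transplant.SkelFrmFromBParamsFaceRunA
import Summits.CriticalPhenomena.PercolationContinuityZ3.Theorems.Transplant.SkelFrmBParamsFaceRunA
import Summits.CriticalPhenomena.PercolationContinuityZ3.Theorems.Transplant.SkelFrmFromBChoiceNums
import Summits.CriticalPhenomena.PercolationContinuityZ3.Theorems.Transplant.SkelFrmBChoiceNums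
import Summits.CriticalPhenomena.PercolationContinuityZ3.Theorems.Transplant.SkelPhiFaceNumsYRun
import Summits.CriticalPhenomena.PercolationContinuityZ3.Theorems.Transplant.SkelNegBParamsFaceFloorsClrXA
import Summits.CriticalPhenomena.PercolationContinuityZ3.Theorems.Transplant.PlanarSkeletonFrmFromDefs
import Summits.CriticalPhenomena.PercolationContinuityZ3.Theorems.Transplant.PlanarSkeletonFrmDefs
import Summits.CriticalPhenomena.PercolationContinuityZ3.Theorems.Transplant.SkelPhiStepIDataNS
import HarnessLib
import Summits.CriticalPhenomena.PercolationContinuityZ3.Theorems.Transplant.SkelFrmBParamsFaceFloorsClrXA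
/-!
# U-WAVE PORT (RULING D-U, lead g21 2026-08-26; WAVE-U-MANIFEST v3.1 row «SkelFrmBParamsFaceFloorsClrXA» ↦ «SkelFrmFromBParamsFaceFloorsClrXA») of the tree module
# `Transplant/SkelFrmBParamsFaceFloorsClrXA` onto the carrier `PlanarSkeletonFrmFrom` (frames only, cylinders connected from width `ℓ₀` on)

ORIGINAL TITLE: (F) VALUE LAYER, N2 twin (hp-8 g42, 2026-08-23; F-DISCHARGE-MAP-N2 G18 x-face seed clearances; (Δ2)/(R-22)): `port_frm.py` text of N1 `SkelNegBParamsFaceFloorsClrXA`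

builds on p205010 (kernel theorem, internal audit signed; external expert review pending) — nothing in this file uses p205010; NOTHING is claimed about the
OPEN node U `SamePDropOfSkeletonFrmFrom₁` (nor U_s / the end state).  Lane `prim-bschramm`, seat `prim-bschramm-stmt` gen 26 (port pen, RULING M-11 family P-stmt; tool = p3-g26's port_u.py of record, registry-driven inputs); helper file
(`--supports stmt-CriticalPhenomena-4575 --as helper`).  PORT RULES r1–r4 of RULING D-U: declaration order and proof texts are those of the original,
byte-identical except (i) the carrier token `PlanarSkeletonFrm ↦ PlanarSkeletonFrmFrom` (binders, `namespace`/`end` lines, qualified names of twinned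
declarations), (ii) carrier-FREE declarations of the original (φ-level `Skelφ…` blocks and namespace-only arithmetic residents) are NOT re-declared —
this file imports the original and `export`s the twin-free residents (POLICY T / treatment (m1)); residents whose statement mentions a twinned
constant are copied, (iii) every carrier-binding declaration keeps its explicit binder `(Φ : PlanarSkeletonFrmFrom G)` in its own signature (r2).  Docstrings and citations are the original's.
-/

noncomputable section

open scoped Classical

namespace Summit.CriticalPhenomena.PercolationContinuityZ3.Theorems.Transplant

namespace PlanarSkeletonFrmFrom

namespace NegB

open Literature.Probability.Percolation Literature.Probability.LatticeModels SimpleGraph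
open Literature.Probability.Percolation.KozmaNitzan.Cells (oth sgOf sgOf_sign)
open SkelConc (Consts)
open Skelφ (shearUnit shearUnit_pos xBoxLoA yBoxLoT yBoxHiT yBoxLoS crossOffX)
open Skelφ.StepI (DataN)
open TwoAxis.Para (modulus)
open Neg

namespace KS

/-! ## §1 Generic arithmetic (chain-free) -/

section Arith

export PlanarSkeletonNeg.NegB.KS (clr_hclrX_of_zero)

export PlanarSkeletonNeg.NegB.KS (clr_yBoxT_range)

export PlanarSkeletonNeg.NegB.KS (clr_tan_alpha_of_room)

export PlanarSkeletonNeg.NegB.KS (clr_mul_sLo_ge)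

export PlanarSkeletonNeg.NegB.KS (clr_tan_level_arith)

end Arith

/-! ## §2 Reading the origin at the (ζ′) tuple -/

section Origin

/-- The shear unit at the long data: `n_L ≤ U ≤ 11·n_L` (`|h_L| ≤ 10 n_L`). [folklore] -/
theorem clr_shearUnit_bounds (κ : Consts) {V : Type} [DecidableEq V] [Countable V] {G : SimpleGraph V} [G.LocallyFinite] (Φ : PlanarSkeletonFrmFrom G) (t : V) (p : unitInterval) (D : Skelφ.StepI.DataNS V) (g : ℕ) (f : ℕ) (hκ : (hL κ Φ t p D g f).natAbs ≤ 10 * nL κ Φ t p D g f) :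
    (nL κ Φ t p D g f : ℤ) ≤ (shearUnit (nL κ Φ t p D g f) (hL κ Φ t p D g f) : ℤ) ∧
      (shearUnit (nL κ Φ t p D g f) (hL κ Φ t p D g f) : ℤ) ≤ 11 * (nL κ Φ t p D g f : ℤ) := by
  unfold Skelφ.shearUnit
  constructor
  · push_cast; linarith [abs_nonneg (hL κ Φ t p D g f)]
  · have : (((hL κ Φ t p D g f).natAbs : ℕ) : ℤ) ≤ ((10 * nL κ Φ t p D g f : ℕ) : ℤ) := by exact_mod_cast hκ
    push_cast at this ⊢; linarith

export PlanarSkeletonNeg.NegB.KS (clr_abs_fun_of_reading)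

/-- **The ordinate reading controls `Λ₁`**: `|F1cA y| ≤ c·u₁` gives `|Λ₁(y)| ≤ (c+1)·m` (`F1cA = (2u₁Λ₁ + m)/(2m)`). [folklore] -/
theorem clr_abs_Λ₁of_le (κ : Consts) {V : Type} [DecidableEq V] [Countable V] {G : SimpleGraph V} [G.LocallyFinite] (Φ : PlanarSkeletonFrmFrom G) (t : V) (p : unitInterval) (D : Skelφ.StepI.DataNS V) (g : ℕ) (f : ℕ) (hN : EqNumL κ Φ t p D g f) (y : Site 2) {c : ℤ} (hc : 0 ≤ c) (h : |F1cA κ Φ t p D g f y| ≤ c * u₁A κ Φ t p D g f) :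
    |Λ₁of κ Φ t p D g f y| ≤ (c + 1) * modulus (nL κ Φ t p D g f) (hL κ Φ t p D g f) (vL κ Φ t p D g f) (vβL κ Φ t p D g f) := by
  obtain ⟨hn1, hℓ1⟩ := one_le_of_eqNumL κ Φ t p D g f hN
  exact clr_abs_fun_of_reading (Skelφ.NegPrm.modulus_vβOf_pos hn1 hℓ1 _ _) (units_eqA κ Φ t p D g f).2.2.2.2.2 hc (F1cA_eq κ Φ t p D g f y) h

/-- **The abscissa reading controls `Λ₀`**: `|FcA y| ≤ c·u₀` gives `|Λ₀(y)| ≤ (c+1)·m`. [folklore] -/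
theorem clr_abs_Λ₀of_le (κ : Consts) {V : Type} [DecidableEq V] [Countable V] {G : SimpleGraph V} [G.LocallyFinite] (Φ : PlanarSkeletonFrmFrom G) (t : V) (p : unitInterval) (D : Skelφ.StepI.DataNS V) (g : ℕ) (f : ℕ) (hN : EqNumL κ Φ t p D g f) (y : Site 2) {c : ℤ} (hc : 0 ≤ c) (h : |FcA κ Φ t p D g f y| ≤ c * u₀A κ Φ t p D g f) :
    |Λ₀of κ Φ t p D g f y| ≤ (c + 1) * modulus (nL κ Φ t p D g f) (hL κ Φ t p D g f) (vL κ Φ t p D g f) (vβL κ Φ t p D g f) := by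
  obtain ⟨hn1, hℓ1⟩ := one_le_of_eqNumL κ Φ t p D g f hN
  exact clr_abs_fun_of_reading (Skelφ.NegPrm.modulus_vβOf_pos hn1 hℓ1 _ _) (units_eqA κ Φ t p D g f).2.2.2.2.1 hc (FcA_eq κ Φ t p D g f y) h

/-- **The abscissa from the two functionals**: `m·y 0 = n_L·Λ₀(y) + v_L·Λ₁(y)`. [folklore] -/
theorem clr_modulus_mul_zero (κ : Consts) {V : Type} [DecidableEq V] [Countable V] {G : SimpleGraph V} [G.LocallyFinite] (Φ : PlanarSkeletonFrmFrom G) (t : V) (p : unitInterval) (D : Skelφ.StepI.DataNS V) (g : ℕ) (f : ℕ) (y : Site 2) :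
    modulus (nL κ Φ t p D g f) (hL κ Φ t p D g f) (vL κ Φ t p D g f) (vβL κ Φ t p D g f) * y 0 =
      (nL κ Φ t p D g f : ℤ) * Λ₀of κ Φ t p D g f y + vL κ Φ t p D g f * Λ₁of κ Φ t p D g f y := by
  unfold Λ₀of Λ₁of vβL TwoAxis.Para.modulus; ring

/-- **The cross shift moves `Λ₁` by less than `n_L`**: `|Λ₁(yTX0 yL σT) − Λ₁(yL)| ≤ n_L` (`n_L·⌊σT h_L v_L/n_L⌋ − σT h_L v_L ∈ (−n_L, 0]`). [folklore] -/
theorem clr_abs_Λ₁of_yTX0_sub (κ : Consts) {V : Type} [DecidableEq V] [Countable V] {G : SimpleGraph V} [G.LocallyFinite] (Φ : PlanarSkeletonFrmFrom G) (t : V) (p : unitInterval) (D : Skelφ.StepI.DataNS V) (g : ℕ) (f : ℕ) (hN : EqNumL κ Φ t p D g f) (yL : Site 2) (σT : ℤ) :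
    |Λ₁of κ Φ t p D g f (yTX0 κ Φ t p D g f yL σT) - Λ₁of κ Φ t p D g f yL| ≤ (nL κ Φ t p D g f : ℤ) := by
  obtain ⟨hn1, -⟩ := one_le_of_eqNumL κ Φ t p D g f hN
  have hn0 : (0 : ℤ) < (nL κ Φ t p D g f : ℤ) := by exact_mod_cast hn1
  obtain ⟨f1, f2⟩ := PlanarSkeletonNeg.NegB.RootArith.floor_sandwich (x := σT * hL κ Φ t p D g f * vL κ Φ t p D g f) hn0
  unfold Λ₁of yTX0
  simp only [Pi.add_apply, Skelφ.pt_zero, Skelφ.pt_one]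
  rw [abs_le]
  constructor
  · nlinarith
  · nlinarith

/-- **The tangential origin's level is the cross-shifted origin's `Λ₁`**: `n_L·yT 1 − h_L·yT 0 = Λ₁(yTX0 yL σT)` for `yT = yL + crossOffX … σ σT Nr`
(the `(Nr+1)` whole strides `(n_L, h_L)` have level `0`). [folklore] -/
theorem clr_lvl_yT_eq (κ : Consts) {V : Type} [DecidableEq V] [Countable V] {G : SimpleGraph V} [G.LocallyFinite] (Φ : PlanarSkeletonFrmFrom G) (t : V) (p : unitInterval) (D : Skelφ.StepI.DataNS V) (g : ℕ) (f : ℕ) (yL : Site 2) (σ σT : ℤ) (Nr : ℕ) :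
    (nL κ Φ t p D g f : ℤ) * (yL + crossOffX (nL κ Φ t p D g f) (hL κ Φ t p D g f) (vL κ Φ t p D g f) σ σT Nr) 1 -
        hL κ Φ t p D g f * (yL + crossOffX (nL κ Φ t p D g f) (hL κ Φ t p D g f) (vL κ Φ t p D g f) σ σT Nr) 0 =
      Λ₁of κ Φ t p D g f (yTX0 κ Φ t p D g f yL σT) := by
  rw [crossOffX_eq]
  unfold Λ₁of
  simp only [Pi.add_apply, Skelφ.pt_zero, Skelφ.pt_one]
  ring

/-- **The tangential origin's level is within `7m + n_L` of the contact's** when `|F1cA yL| ≤ 6u₁`. [folklore] -/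
theorem clr_abs_lvl_yT_le (κ : Consts) {V : Type} [DecidableEq V] [Countable V] {G : SimpleGraph V} [G.LocallyFinite] (Φ : PlanarSkeletonFrmFrom G) (t : V) (p : unitInterval) (D : Skelφ.StepI.DataNS V) (g : ℕ) (f : ℕ) (hN : EqNumL κ Φ t p D g f) (yL : Site 2) (he1 : |F1cA κ Φ t p D g f yL| ≤ 6 * u₁A κ Φ t p D g f) (σ σT : ℤ) (Nr : ℕ) :
    |(nL κ Φ t p D g f : ℤ) * (yL + crossOffX (nL κ Φ t p D g f) (hL κ Φ t p D g f) (vL κ Φ t p D g f) σ σT Nr) 1 -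
        hL κ Φ t p D g f * (yL + crossOffX (nL κ Φ t p D g f) (hL κ Φ t p D g f) (vL κ Φ t p D g f) σ σT Nr) 0| ≤
      7 * modulus (nL κ Φ t p D g f) (hL κ Φ t p D g f) (vL κ Φ t p D g f) (vβL κ Φ t p D g f) + (nL κ Φ t p D g f : ℤ) := by
  rw [clr_lvl_yT_eq]
  have h1 := clr_abs_Λ₁of_le κ Φ t p D g f hN yL (by norm_num : (0:ℤ) ≤ 6) he1
  have h2 := clr_abs_Λ₁of_yTX0_sub κ Φ t p D g f hN yL σT
  have h3 := abs_le.1 h1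
  have h4 := abs_le.1 h2
  rw [abs_le]; constructor <;> linarith

/-- **The cross-shifted origin is within `15·n_L` of the contact in abscissa** when `|FcA(yTX0 yL σT)| ≤ 6u₀`, `|F1cA yL| ≤ 6u₁` (and `ℓ_L ≥ 2`).
[folklore] -/
theorem clr_abs_yTX0_zero_le (κ : Consts) {V : Type} [DecidableEq V] [Countable V] {G : SimpleGraph V} [G.LocallyFinite] (Φ : PlanarSkeletonFrmFrom G) (t : V) (p : unitInterval) (D : Skelφ.StepI.DataNS V) (g : ℕ) (f : ℕ) (hN : EqNumL κ Φ t p D g f) (hℓ2 : 2 ≤ ℓL κ Φ t p D g f) (yL : Site 2) (σT : ℤ)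
    (he0 : |FcA κ Φ t p D g f (yTX0 κ Φ t p D g f yL σT)| ≤ 6 * u₀A κ Φ t p D g f) (he1 : |F1cA κ Φ t p D g f yL| ≤ 6 * u₁A κ Φ t p D g f) :
    |yTX0 κ Φ t p D g f yL σT 0| ≤ 15 * (nL κ Φ t p D g f : ℤ) := by
  obtain ⟨hn1, hℓ1⟩ := one_le_of_eqNumL κ Φ t p D g f hN
  have hn0 : (0 : ℤ) < (nL κ Φ t p D g f : ℤ) := by exact_mod_cast hn1
  obtain ⟨hm1, -⟩ := Skelφ.NegPrm.modulus_vβOf hn1 (hL κ Φ t p D g f) (ℓL κ Φ t p D g f) (vL κ Φ t p D g f)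
  have e : Skelφ.NegPrm.vβOf (nL κ Φ t p D g f) (hL κ Φ t p D g f) (ℓL κ Φ t p D g f) (vL κ Φ t p D g f) = vβL κ Φ t p D g f := rfl
  rw [e] at hm1
  have hv := hN.v_le
  have h0 := abs_le.1 (clr_abs_Λ₀of_le κ Φ t p D g f hN (yTX0 κ Φ t p D g f yL σT) (by norm_num : (0:ℤ) ≤ 6) he0)
  have h1 := abs_le.1 (clr_abs_Λ₁of_le κ Φ t p D g f hN yL (by norm_num : (0:ℤ) ≤ 6) he1)
  have h2 := abs_le.1 (clr_abs_Λ₁of_yTX0_sub κ Φ t p D g f hN yL σT)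
  have key := clr_modulus_mul_zero κ Φ t p D g f (yTX0 κ Φ t p D g f yL σT)
  set m := modulus (nL κ Φ t p D g f) (hL κ Φ t p D g f) (vL κ Φ t p D g f) (vβL κ Φ t p D g f)
  set n : ℤ := (nL κ Φ t p D g f : ℤ)
  set v := vL κ Φ t p D g f
  set L0 := Λ₀of κ Φ t p D g f (yTX0 κ Φ t p D g f yL σT)
  set L1 := Λ₁of κ Φ t p D g f (yTX0 κ Φ t p D g f yL σT)
  set y0 := yTX0 κ Φ t p D g f yL σT 0
  have hℓ' : (2 : ℤ) ≤ (ℓL κ Φ t p D g f : ℤ) := by exact_mod_cast hℓ2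
  have hnm : n ≤ m := by nlinarith
  have hm0 : 0 < m := by linarith
  have hL1 : |L1| ≤ 8 * m := by rw [abs_le]; constructor <;> linarith [h1.1, h1.2, h2.1, h2.2]
  have hL0 : |L0| ≤ 7 * m := abs_le.2 ⟨h0.1, h0.2⟩
  have hvL : |v * L1| ≤ n * (8 * m) := by rw [abs_mul]; exact mul_le_mul hv hL1 (abs_nonneg _) hn0.le
  have hnL : |n * L0| ≤ n * (7 * m) := by rw [abs_mul, abs_of_pos hn0]; exact mul_le_mul_of_nonneg_left hL0 hn0.le
  have hsum : |m * y0| ≤ 15 * n * m := by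
    rw [key]
    calc |n * L0 + v * L1| ≤ |n * L0| + |v * L1| := abs_add_le _ _
      _ ≤ n * (7 * m) + n * (8 * m) := add_le_add hnL hvL
      _ = 15 * n * m := by ring
  rw [abs_mul, abs_of_pos hm0] at hsum
  have : m * |y0| ≤ m * (15 * n) := by linarith
  exact le_of_mul_le_mul_left this hm0

end Origin

/-! ## §3 The two G-clr fields at the (ζ′) tuple -/

section Fields

/-- **THE ALONG COUNT IS AT LEAST `200·Kq − 8`**: the along target is `≥ 5r₀ + 1 − E − 6u₀ = (200·Kq − 6)u₀ + 1 − E` ahead of the cross-shifted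
origin and the run ends within one stride of it (`NrX_spec`). [folklore] -/
theorem clr_NrX_lb (κ : Consts) {V : Type} [DecidableEq V] [Countable V] {G : SimpleGraph V} [G.LocallyFinite] (Φ : PlanarSkeletonFrmFrom G) (t : V) (p : unitInterval) (D : Skelφ.StepI.DataNS V) (g : ℕ) (f : ℕ) (P : PCells2T) (hP : P.toPCells2 = fcellsA κ Φ t p D g f) (hN : EqNumL κ Φ t p D g f) (x : Site 2) (du : MDir) (hd : du.1 = 0) (z : Site 2) {j E : ℕ} (hj : j < P.K)
    (hlev1 : P.faceL 0 j - E ≤ P.lev du x z)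
    (hlev2 : P.lev du x z ≤ P.faceL 0 j + E) (hEu : (E : ℤ) ≤ u₀A κ Φ t p D g f)
    (yL : Site 2) (σT : ℤ) (he0 : |FcA κ Φ t p D g f (yTX0 κ Φ t p D g f yL σT)| ≤ 6 * u₀A κ Φ t p D g f) :
    200 * (Neg.Kq κ : ℤ) ≤ (NrX κ Φ t p D g f P yL σT x du z : ℤ) + 8 := by
  obtain ⟨a1, -⟩ := along_target_bounds κ Φ t p D g f P hP x du hd z hj hlev1 hlev2 yL σT he0
  have hu : 1 ≤ u₀A κ Φ t p D g f := (units_eqA κ Φ t p D g f).2.2.2.2.1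
  obtain ⟨hX, -⟩ := NrX_range κ Φ t p D g f P hP hN x du hd z hj hlev1 hlev2 yL σT he0 (by linarith)
  obtain ⟨hf, -⟩ := NrX_spec κ Φ t p D g f P hN yL σT x du z hX
  rw [FcA_crossOffX κ Φ t p D g f hN] at hf
  have hr : (P.r 0 : ℤ) = 40 * (Neg.Kq κ : ℤ) * u₀A κ Φ t p D g f := by rw [(cells_of_hP κ Φ t p D g f P hP).1 0]; exact (units_eqA κ Φ t p D g f).2.2.1
  have hσ : sgOf du = 1 ∨ sgOf du = -1 := sgOf_sign du
  set u := u₀A κ Φ t p D g f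
  set Q : ℤ := (Neg.Kq κ : ℤ)
  set N : ℤ := (NrX κ Φ t p D g f P yL σT x du z : ℤ)
  set T := T0X P x du z
  set F := FcA κ Φ t p D g f (yTX0 κ Φ t p D g f yL σT)
  obtain ⟨hf1, hf2⟩ := abs_le.1 hf
  -- `u·(N+1) ≥ σ·(T − F) − u ≥ 200Qu + 1 − E − 7u ≥ (200Q − 8)u + 1`
  have key : (200 * Q - 8) * u + 1 ≤ u * (N + 1) := by
    rcases hσ with h | h <;> rw [h] at hf1 hf2 a1 <;> nlinarith
  by_contra hc
  push Not at hc
  have h1 : N + 9 - 200 * Q ≤ 0 := by linarith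
  have h2 : u * (N + 9 - 200 * Q) ≤ 0 := mul_nonpos_of_nonneg_of_nonpos (by linarith) h1
  nlinarith

/-- **M3 x-face field `hclr`** at the (ζ′) tuple (pinned conclusion; premise block trimmed; ONE added hypothesis `hyL`, the `k = 0` floor of the landing
origin in RootCases' `hclr_s` shape — served per bridge case by the origins group G-O): the along x-run never dips into the seed box.
[cite: KozmaNitzan2024, §4 Lemma 12 (pp. 23–25)] -/
theorem hclr_XA (κ : Consts) {V : Type} [DecidableEq V] [Countable V] {G : SimpleGraph V} [G.LocallyFinite] (Φ : PlanarSkeletonFrmFrom G) (t : V) (p : unitInterval) (D : Skelφ.StepI.DataNS V) (mk : ℕ) (g : ℕ) (f : ℕ) (P : PCells2T) (hnA : 2000 * Neg.Kq κ * (KS0.R'0 κ Φ t p D mk + 2) ≤ nL κ Φ t p D g f) (x : Site 2) (du : MDir) (z : Site 2) (yL : Site 2) (qB : ℕ)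
    (hyL : ((Mu D : ℕ) : ℤ) < sgOf du * yL 0 - (qB : ℤ) - (KS0.R'0 κ Φ t p D mk : ℤ) - (nL κ Φ t p D g f : ℤ)) :
    ∀ k ≤ (NrX κ Φ t p D g f P yL (σTX κ Φ t p D g f P yL x du z) x du z), ((Mu D : ℕ) : ℤ) < xBoxLoA (nL κ Φ t p D g f) qB (KS0.R'0 κ Φ t p D mk) k + sgOf du * yL 0 := by
  intro k _
  have hRn : KS0.R'0 κ Φ t p D mk ≤ nL κ Φ t p D g f := by
    have : KS0.R'0 κ Φ t p D mk ≤ 2000 * Neg.Kq κ * (KS0.R'0 κ Φ t p D mk + 2) := by have := Neg.one_le_Kq κ; nlinarith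
    omega
  exact clr_hclrX_of_zero hRn (by linarith) k

/-- `M_u + 2 ≤ R'0` for the (S0) kit (`R'0 = j₁0 + reach0 + 1`, `reach0 ≥ KCmax = 11·(Dsh + M_u + 1)`; N1's `Mu_add_two_le_RA'` for the apron kit). [folklore] -/
theorem Mu_add_two_le_R'0 (κ : Consts) {V : Type} [DecidableEq V] [Countable V] {G : SimpleGraph V} [G.LocallyFinite] (Φ : PlanarSkeletonFrmFrom G) (t : V) (p : unitInterval)
    (D : Skelφ.StepI.DataNS V) (mk : ℕ) : Mu D + 2 ≤ KS0.R'0 κ Φ t p D mk := by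
  rw [(KS0.R'0_eq κ Φ t p D mk).1]
  unfold KS0.reach0 KS.KCmax
  nlinarith [Nat.zero_le (KS0.j₁0 κ Φ t p D mk), Nat.zero_le (KS0.T0 t D mk), Nat.zero_le (KS.da t D mk), Nat.zero_le (KS.Dsh t D mk)]

/-- **M3 x-face field `hclr₃`** at the (ζ′) tuple (pinned conclusion; premise block trimmed; NO added hypothesis): every region of the tangential
y′-run is clear of the seed box — by abscissa for `k ≤ 30`, by level for `k ≥ 31`. [cite: KozmaNitzan2024, §4 Lemma 12 (pp. 23–25)]
[cite: MartineauTassion2017, §4.3 Lemma 4.2] -/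
theorem hclr₃_XA (κ : Consts) {V : Type} [DecidableEq V] [Countable V] {G : SimpleGraph V} [G.LocallyFinite] (Φ : PlanarSkeletonFrmFrom G) (t : V) (p : unitInterval) (D : Skelφ.StepI.DataNS V) (mk : ℕ) (g : ℕ) (f : ℕ) (P : PCells2T) (hP : P.toPCells2 = fcellsA κ Φ t p D g f) (hN : EqNumL κ Φ t p D g f) (hκ : (hL κ Φ t p D g f).natAbs ≤ 10 * nL κ Φ t p D g f)
    (hnA : 2000 * Neg.Kq κ * (KS0.R'0 κ Φ t p D mk + 2) ≤ nL κ Φ t p D g f) (hℓA : 22000 * Neg.Kq κ * (KS0.R'0 κ Φ t p D mk + 2) ≤ ℓL κ Φ t p D g f)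
    (x : Site 2) (du : MDir) (hd : du.1 = 0) (j : ℕ) (hj : j < P.K) (z : Site 2) {E : ℕ}
    (hlev1 : P.faceL 0 j - E ≤ P.lev du x z) (hlev2 : P.lev du x z ≤ P.faceL 0 j + E)
    (hEu : (E : ℤ) ≤ u₀A κ Φ t p D g f)
    (yL : Site 2) (he0 : |FcA κ Φ t p D g f (yTX0 κ Φ t p D g f yL (σTX κ Φ t p D g f P yL x du z))| ≤ 6 * u₀A κ Φ t p D g f)
    (he1 : |F1cA κ Φ t p D g f yL| ≤ 6 * u₁A κ Φ t p D g f) :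
    ∀ k ≤ (N3X κ Φ t p D g f P yL x du z), (∀ b : ℤ, min ((σTX κ Φ t p D g f P yL x du z) * yBoxLoT (nL κ Φ t p D g f) (prFA κ Φ t p D g f).vα (KS0.R'0 κ Φ t p D mk) k) ((σTX κ Φ t p D g f P yL x du z) * yBoxHiT (nL κ Φ t p D g f) (prFA κ Φ t p D g f).vα (KS0.R'0 κ Φ t p D mk) k) ≤ b → b ≤ max ((σTX κ Φ t p D g f P yL x du z) * yBoxLoT (nL κ Φ t p D g f) (prFA κ Φ t p D g f).vα (KS0.R'0 κ Φ t p D mk) k) ((σTX κ Φ t p D g f P yL x du z) * yBoxHiT (nL κ Φ t p D g f) (prFA κ Φ t p D g f).vα (KS0.R'0 κ Φ t p D mk) k) → ((Mu D : ℕ) : ℤ) < sgOf du * (b + (yL + crossOffX (nL κ Φ t p D g f) (prFA κ Φ t p D g f).h (prFA κ Φ t p D g f).vα (sgOf du) (σTX κ Φ t p D g f P yL x du z) (NrX κ Φ t p D g f P yL (σTX κ Φ t p D g f P yL x du z) x du z)) 0)) ∨ ((shearUnit (nL κ Φ t p D g f) (prFA κ Φ t p D g f).h : ℤ) * (Mu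 D) + |(((nL κ Φ t p D g f) : ℕ) : ℤ) * (yL + crossOffX (nL κ Φ t p D g f) (prFA κ Φ t p D g f).h (prFA κ Φ t p D g f).vα (sgOf du) (σTX κ Φ t p D g f P yL x du z) (NrX κ Φ t p D g f P yL (σTX κ Φ t p D g f P yL x du z) x du z)) 1 - (prFA κ Φ t p D g f).h * (yL + crossOffX (nL κ Φ t p D g f) (prFA κ Φ t p D g f).h (prFA κ Φ t p D g f).vα (sgOf du) (σTX κ Φ t p D g f P yL x du z) (NrX κ Φ t p D g f P yL (σTX κ Φ t p D g f P yL x du z) x du z)) 0| < (shearUnit (nL κ Φ t p D g f) (prFA κ Φ t p D g f).h : ℤ) * yBoxLoS (nL κ Φ t p D g f) (ℓL κ Φ t p D g f) (prFA κ Φ t p D g f).h (qB3XA κ Φ t p D g f (KS0.R'0 κ Φ t p D mk)) (KS0.R'0 κ Φ t p D mk) k) := by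
  have eh : (prFA κ Φ t p D g f).h = hL κ Φ t p D g f := rfl
  have ev : (prFA κ Φ t p D g f).vα = vL κ Φ t p D g f := rfl
  simp only [eh, ev]
  intro k hk
  obtain ⟨hn1, hℓ1⟩ := one_le_of_eqNumL κ Φ t p D g f hN
  have hn0 : (1 : ℤ) ≤ (nL κ Φ t p D g f : ℤ) := by exact_mod_cast hn1
  have hv := hN.v_le
  have hσ : sgOf du = 1 ∨ sgOf du = -1 := sgOf_sign du
  have hσT := (N3X_spec κ Φ t p D g f P yL x du z).1
  have hq1 : (1 : ℤ) ≤ (Neg.Kq κ : ℤ) := by exact_mod_cast Neg.one_le_Kq κ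
  have hR0 : (0 : ℤ) ≤ (KS0.R'0 κ Φ t p D mk : ℤ) := Nat.cast_nonneg _
  have hnA' : 2000 * (Neg.Kq κ : ℤ) * ((KS0.R'0 κ Φ t p D mk : ℤ) + 2) ≤ (nL κ Φ t p D g f : ℤ) := by exact_mod_cast hnA
  have hℓA' : 22000 * (Neg.Kq κ : ℤ) * ((KS0.R'0 κ Φ t p D mk : ℤ) + 2) ≤ (ℓL κ Φ t p D g f : ℤ) := by exact_mod_cast hℓA
  have hMz : ((Mu D : ℕ) : ℤ) + 2 ≤ (KS0.R'0 κ Φ t p D mk : ℤ) := by exact_mod_cast Mu_add_two_le_R'0 κ Φ t p D mk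
  have hℓ2 : 2 ≤ ℓL κ Φ t p D g f := by
    have : (2 : ℤ) ≤ (ℓL κ Φ t p D g f : ℤ) := by nlinarith
    exact_mod_cast this
  by_cases hk30 : k ≤ 30
  · -- the α-branch: the region's transverse range is far on the `σ` side
    left
    have hNr := clr_NrX_lb κ Φ t p D g f P hP hN x du hd z hj hlev1 hlev2 hEu yL (σTX κ Φ t p D g f P yL x du z) he0
    have hy0 := abs_le.1 (clr_abs_yTX0_zero_le κ Φ t p D g f hN hℓ2 yL (σTX κ Φ t p D g f P yL x du z) he0 he1)
    refine clr_tan_alpha_of_room hv (KS0.R'0 κ Φ t p D mk) k hσ hσT ?_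
    -- `σ·yT 0 = σ·(yTX0 yL σT) 0 + (Nr+1)·n ≥ −15n + (200Q − 7)·n`
    rw [crossOffX_eq, Pi.add_apply, Skelφ.pt_zero]
    set σ := sgOf du
    set N : ℤ := (NrX κ Φ t p D g f P yL (σTX κ Φ t p D g f P yL x du z) x du z : ℤ)
    set n : ℤ := (nL κ Φ t p D g f : ℤ)
    set Y := yTX0 κ Φ t p D g f yL (σTX κ Φ t p D g f P yL x du z) 0
    have hk' : (k : ℤ) ≤ 30 := by exact_mod_cast hk30
    have hσsq : σ * σ = 1 := by rcases hσ with h | h <;> rw [h] <;> norm_num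
    have e2 : σ * (Y + σ * (N + 1) * n) = σ * Y + (N + 1) * n := by linear_combination ((N + 1) * n) * hσsq
    rw [e2]
    have hσy : -(15 * n) ≤ σ * Y := by
      rcases hσ with h | h <;> rw [h] <;> linarith [hy0.1, hy0.2]
    have hNn : (200 * (Neg.Kq κ : ℤ) - 7) * n ≤ (N + 1) * n := mul_le_mul_of_nonneg_right (by linarith) (by linarith)
    have hkn : ((k : ℤ) + 3) * n ≤ 33 * n := mul_le_mul_of_nonneg_right (by linarith) (by linarith)
    have hkR : ((k : ℤ) + 1) * (KS0.R'0 κ Φ t p D mk : ℤ) ≤ 31 * (KS0.R'0 κ Φ t p D mk : ℤ) := mul_le_mul_of_nonneg_right (by linarith) hR0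
    nlinarith
  · -- the level branch: the region sits `≥ 31` level strides above the origin
    right
    push Not at hk30
    have hk31 : (31 : ℤ) ≤ (k : ℤ) := by exact_mod_cast hk30
    obtain ⟨hU1, hU2⟩ := clr_shearUnit_bounds κ Φ t p D g f hκ
    obtain ⟨-, hm2⟩ := Skelφ.NegPrm.modulus_vβOf hn1 (hL κ Φ t p D g f) (ℓL κ Φ t p D g f) (vL κ Φ t p D g f)
    have e : Skelφ.NegPrm.vβOf (nL κ Φ t p D g f) (hL κ Φ t p D g f) (ℓL κ Φ t p D g f) (vL κ Φ t p D g f) = vβL κ Φ t p D g f := rfl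
    rw [e] at hm2
    have hlv := clr_abs_lvl_yT_le κ Φ t p D g f hN yL he1 (sgOf du) (σTX κ Φ t p D g f P yL x du z) (NrX κ Φ t p D g f P yL (σTX κ Φ t p D g f P yL x du z) x du z)
    have hs := clr_mul_sLo_ge hn1 (hL κ Φ t p D g f) (ℓL κ Φ t p D g f)
    obtain ⟨hW, hLb⟩ := Wrun_spec κ Φ t p D g f hn1
    unfold Lbrun at hLb
    unfold Wrun at hW
    have hq : (shearUnit (nL κ Φ t p D g f) (hL κ Φ t p D g f) : ℤ) * (qB3XA κ Φ t p D g f (KS0.R'0 κ Φ t p D mk) : ℤ) ≤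
        (nL κ Φ t p D g f : ℤ) * (ℓL κ Φ t p D g f : ℤ) + 3 * (shearUnit (nL κ Φ t p D g f) (hL κ Φ t p D g f) : ℤ) +
          1000 * (Neg.Kq κ : ℤ) * (KS0.R'0 κ Φ t p D mk : ℤ) * (shearUnit (nL κ Φ t p D g f) (hL κ Φ t p D g f) : ℤ) := by
      have eq : (qB3XA κ Φ t p D g f (KS0.R'0 κ Φ t p D mk) : ℤ) =
          ((nL κ Φ t p D g f * ℓL κ Φ t p D g f / shearUnit (nL κ Φ t p D g f) (hL κ Φ t p D g f) + 1 : ℕ) : ℤ) +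
            1000 * (Neg.Kq κ : ℤ) * (KS0.R'0 κ Φ t p D mk : ℤ) + 2 := by
        unfold qB3XA Wrun; push_cast; ring
      rw [eq]
      set U : ℤ := (shearUnit (nL κ Φ t p D g f) (hL κ Φ t p D g f) : ℤ)
      set W : ℤ := ((nL κ Φ t p D g f * ℓL κ Φ t p D g f / shearUnit (nL κ Φ t p D g f) (hL κ Φ t p D g f) + 1 : ℕ) : ℤ)
      have hU0 : 0 ≤ U := by linarith
      have : U * (W + 1000 * (Neg.Kq κ : ℤ) * (KS0.R'0 κ Φ t p D mk : ℤ) + 2) = U * W + 2 * U + 1000 * (Neg.Kq κ : ℤ) * (KS0.R'0 κ Φ t p D mk : ℤ) * U := by ring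
      rw [this]
      linarith
    unfold Skelφ.yBoxLoS
    exact clr_tan_level_arith hn0 hU1 hU2 hR0 hq1 hℓA' hm2 hMz hlv hk31 hs hq hLb

end Fields

end KS

end NegB

end PlanarSkeletonFrmFrom

end Summit.CriticalPhenomena.PercolationContinuityZ3.Theorems.Transplant

end
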